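import Summits.CriticalPhenomena.PercolationContinuityZ3.Theorems.PercNearOneGluingNoHeavyLowerTailMajorityGluingQCertVec
import HarnessLib

/-!
# Soundness of the kernel-checked degree-2 certificates (lane prim-rate, constants-miner 1, gen 34; CANDIDATES §GEN-33 R324, NEXT-g34 item 1)

Support file for the closed crux `NoHeavyLowerTail` (stmt-CriticalPhenomena-4575), majority-gluing line; companion of `…MajorityGluingQCert`
(the certificate language, the specification `Cert.S`, the structural check) and `…MajorityGluingQCertVec` (the kernel evaluation `checkQ`).  Here: the value of every certificate entry at a real point (`quadv_rowCoef`,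
`quadv_sqCoef`, `Cert.quadv_linC`, …) and **`Cert.sound`**: if `checkW` and `checkQ 0 NV` pass, then at every nonnegative point `v` with
the marginal hypotheses `m_x(v) ≤ v_D` (`x < m`), the case chain `E_x(v) ≤ E_{x+1}(v)` (`x + 1 < m`) and the listed rows
(`f₁·f₂ ≤ f₃·f₄` on the mask forms), `cD·T(v) ≤ cN·v_D`.  Proof: the symmetrised coefficient array is nonnegative, so
`0 ≤ quadv C v = (linear part) + (rows) + (squares) ≤ Λ·ℓ(v)` with `Λ = cN·v_D − cD·T(v)` and `ℓ(v) ≥ ℓ_D·v_D`; if `v_D > 0` then `Λ ≥ 0`,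
and if `v_D = 0` the marginals force `T(v) = 0`.  No percolation, no sorries.
-/

namespace Summit.CriticalPhenomena.PercolationContinuityZ3.Theorems

namespace HubOnly
namespace QCert

noncomputable section

/-! ### Small list lemmas -/

/-- Monotonicity of list sums. -/
theorem listSum_mono {α : Type*} (l : List α) (f g : α → ℝ) (h : ∀ a ∈ l, f a ≤ g a) :
    (l.map f).sum ≤ (l.map g).sum := by
  induction l with
  | nil => simp
  | cons a l ih =>
    simp only [List.map_cons, List.sum_cons]
    exact add_le_add (h a (by simp)) (ih fun b hb => h b (List.mem_cons_of_mem _ hb))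

/-- A list sum of nonpositive terms is nonpositive. -/
theorem listSum_nonpos {α : Type*} (l : List α) (f : α → ℝ) (h : ∀ a ∈ l, f a ≤ 0) : (l.map f).sum ≤ 0 := by
  have := listSum_mono l f (fun _ => 0) h
  simpa using this

/-- Casting a list sum of naturals. -/
theorem natCast_listSum {α : Type*} (l : List α) (f : α → ℕ) : (((l.map f).sum : ℕ) : ℝ) = (l.map fun a => (f a : ℝ)).sum := by
  induction l with
  | nil => simp
  | cons a l ih => simp only [List.map_cons, List.sum_cons, Nat.cast_add, ih]

/-- Pulling a constant factor out of a list sum. -/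
theorem listSum_mul_const {α : Type*} (l : List α) (f : α → ℝ) (k : ℝ) :
    (l.map fun a => f a * k).sum = (l.map f).sum * k := by
  induction l with
  | nil => simp
  | cons a l ih => simp only [List.map_cons, List.sum_cons, ih]; ring

/-! ### Semantics of the entries -/

/-- The `quadv` of a row is `n·(f₁·f₂ − f₃·f₄)` on the mask forms. -/
theorem quadv_rowCoef (N : ℕ) (r : RowE) (v : ℕ → ℝ) :
    quadv N r.coef v = r.n * (linv N (fun i => Cert.bi (tb r.m1 i)) v * linv N (fun i => Cert.bi (tb r.m2 i)) v -
      linv N (fun i => Cert.bi (tb r.m3 i)) v * linv N (fun i => Cert.bi (tb r.m4 i)) v) := by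
  have e : r.coef = fun i j => ((r.n : ℤ) * Cert.bi (tb r.m1 i)) * Cert.bi (tb r.m2 j) +
      ((-(r.n : ℤ)) * Cert.bi (tb r.m3 i)) * Cert.bi (tb r.m4 j) := by
    funext i j
    unfold RowE.coef Cert.bi
    cases tb r.m1 i <;> cases tb r.m2 j <;> cases tb r.m3 i <;> cases tb r.m4 j <;> simp
  rw [e, quadv_add, quadv_mul, quadv_mul, linv_smul, linv_smul]
  push_cast; ring

/-- The `quadv` of a square entry is `−n·u²`. -/
theorem quadv_sqCoef (N : ℕ) (s : SqE) (v : ℕ → ℝ) : quadv N s.coef v = -(s.n * (linv N s.u v * linv N s.u v)) := by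
  have e : s.coef = fun i j => ((-(s.n : ℤ)) * s.u i) * s.u j := by
    funext i j
    unfold SqE.coef
    split_ifs with h
    · rw [h]; ring
    · ring
  rw [e, quadv_mul, linv_smul]; push_cast; ring

namespace Cert

variable (c : Cert)

/-- The value `Σ_e n·G_e(v)` of a group of linear entries. -/
def gval (es : List LinE) (v : ℕ → ℝ) : ℝ := (es.map fun e => (e.n : ℝ) * linv c.NV (c.G e) v).sum

/-- The `quadv` of the linear part: `Σ_groups [b < NV]·gval·v_b`. -/
theorem quadv_linC (v : ℕ → ℝ) :
    quadv c.NV c.linC v = (c.lin.map fun g => if g.1 < c.NV then c.gval g.2 v * v g.1 else 0).sum := by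
  unfold linC
  rw [quadv_listSum]
  congr 1
  refine List.map_congr_left fun g _ => ?_
  rw [show (fun i j => if g.1 = j then (g.2.map fun e => (e.n : ℤ) * c.G e i).sum else 0) =
      fun i j => if g.1 = j then (fun i' => (g.2.map fun e => (e.n : ℤ) * c.G e i').sum) i else 0 from rfl, quadv_col]
  split_ifs with hb
  · congr 1
    unfold gval
    rw [show (fun i' => (g.2.map fun e => (e.n : ℤ) * c.G e i').sum) = fun i' => (g.2.map fun e => (fun e' i'' => (e'.n : ℤ) * c.G e' i'') e i').sum
      from rfl, linv_listSum]
    congr 1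
    refine List.map_congr_left fun e _ => ?_
    rw [linv_smul c.NV (e.n : ℤ) (c.G e) v]
    push_cast; ring
  · rfl

/-- The `quadv` of the row part. -/
theorem quadv_rowC (v : ℕ → ℝ) :
    quadv c.NV c.rowC v = (c.rows.map fun ch => (ch.map fun r => quadv c.NV r.coef v).sum).sum := by
  unfold rowC
  rw [quadv_listSum]
  congr 1
  refine List.map_congr_left fun ch _ => ?_
  rw [quadv_listSum]

/-- The `quadv` of the square part. -/
theorem quadv_sqC (v : ℕ → ℝ) :
    quadv c.NV c.sqC v = (c.sqs.map fun ch => (ch.map fun s => quadv c.NV s.coef v).sum).sum := by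
  unfold sqC
  rw [quadv_listSum]
  congr 1
  refine List.map_congr_left fun ch _ => ?_
  rw [quadv_listSum]

/-! ### The linear entries -/

/-- The value of the conclusion form `cN·x_D − cD·T`. -/
def Λ (v : ℕ → ℝ) : ℝ := c.cN * v c.D - c.cD * linv c.NV (fun i => bi (c.tMem i)) v

/-- `D < NV`. -/
theorem D_lt_NV : c.D < c.NV := by unfold D NV; omega

/-- A kind-`0` entry evaluates to `Λ`. -/
theorem linv_G_zero (e : LinE) (hk : e.kind = 0) (v : ℕ → ℝ) : linv c.NV (c.G e) v = c.Λ v := by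
  have e1 : c.G e = fun i => (c.cN : ℤ) * (if i = c.D then 1 else 0) - (c.cD : ℤ) * bi (c.tMem i) := by
    funext i; unfold G bi; rw [if_pos hk]; split_ifs <;> simp
  rw [e1, linv_sub c.NV (fun i => (c.cN : ℤ) * (if i = c.D then 1 else 0)) (fun i => (c.cD : ℤ) * bi (c.tMem i)) v,
    linv_smul, linv_smul, linv_single c.NV c.D c.D_lt_NV]
  unfold Λ; push_cast; ring

/-- A kind-`1` entry evaluates to `m_x(v) − v_D`. -/
theorem linv_G_one (e : LinE) (hk : e.kind = 1) (v : ℕ → ℝ) :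
    linv c.NV (c.G e) v = linv c.NV (fun i => bi (c.margMem e.x i)) v - v c.D := by
  have e1 : c.G e = fun i => bi (c.margMem e.x i) - (if i = c.D then 1 else 0) := by
    funext i; unfold G; rw [if_neg (by omega), if_pos hk]
  rw [e1, linv_sub c.NV (fun i => bi (c.margMem e.x i)) (fun i => if i = c.D then 1 else 0) v, linv_single c.NV c.D c.D_lt_NV]

/-- An entry of kind `≥ 2` evaluates to `E_x(v) − E_{x+1}(v)`. -/
theorem linv_G_two (e : LinE) (hk0 : e.kind ≠ 0) (hk1 : e.kind ≠ 1) (v : ℕ → ℝ) :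
    linv c.NV (c.G e) v = linv c.NV (fun i => bi (c.eMem e.x i)) v - linv c.NV (fun i => bi (c.eMem (e.x + 1) i)) v := by
  have e1 : c.G e = fun i => bi (c.eMem e.x i) - bi (c.eMem (e.x + 1) i) := by
    funext i; unfold G; rw [if_neg hk0, if_neg hk1]
  rw [e1, linv_sub]

/-- The `x_D`-weight `Σ_{kind 0} n` of a group. -/
def ellG (es : List LinE) : ℕ := (es.map fun e => if e.kind = 0 then e.n else 0).sum

/-- **A well-formed group is bounded by its `x_D`-weight times `Λ`** (the kind-`1`/`2` entries are nonpositive under the hypotheses). -/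
theorem gval_le (v : ℕ → ℝ)
    (hmarg : ∀ x < c.m, linv c.NV (fun i => bi (c.margMem x i)) v ≤ v c.D)
    (hcase : ∀ x, x + 1 < c.m → linv c.NV (fun i => bi (c.eMem x i)) v ≤ linv c.NV (fun i => bi (c.eMem (x + 1) i)) v)
    (g : ℕ × List LinE) (hg : c.linOK g = true) : c.gval g.2 v ≤ (ellG g.2 : ℝ) * c.Λ v := by
  unfold linOK at hg
  simp only [Bool.and_eq_true, decide_eq_true_eq, List.all_eq_true, Bool.or_eq_true, Bool.not_eq_true',
    beq_eq_false_iff_ne, ne_eq] at hg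
  obtain ⟨_, hes⟩ := hg
  unfold gval ellG
  rw [natCast_listSum, ← listSum_mul_const]
  refine listSum_mono _ _ _ fun e he => ?_
  obtain ⟨⟨hk2, hx1⟩, hx2⟩ := hes e he
  by_cases h0 : e.kind = 0
  · rw [c.linv_G_zero e h0, if_pos h0]
  · rw [if_neg h0, Nat.cast_zero, zero_mul]
    have hn : (0 : ℝ) ≤ e.n := Nat.cast_nonneg _
    by_cases h1 : e.kind = 1
    · have hx : e.x < c.m := by
        rcases hx1 with h | h
        · exact absurd h1 h
        · exact h
      rw [c.linv_G_one e h1]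
      have := hmarg e.x hx
      exact mul_nonpos_of_nonneg_of_nonpos hn (by linarith)
    · have hk : e.kind = 2 := by omega
      have hx : e.x + 1 < c.m := by
        rcases hx2 with h | h
        · exact absurd hk h
        · exact h
      rw [c.linv_G_two e h0 h1]
      have := hcase e.x hx
      exact mul_nonpos_of_nonneg_of_nonpos hn (by linarith)

/-- The multiplier `ℓ(v) = Σ_groups ellG·v_b` of the conclusion. -/
def ellv (v : ℕ → ℝ) : ℝ := (c.lin.map fun g => (ellG g.2 : ℝ) * v g.1).sum

/-- `ℓ(v) ≥ ℓ_D·v_D` at a nonnegative point. -/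
theorem ellD_mul_le (v : ℕ → ℝ) (hv : ∀ i, 0 ≤ v i) : (c.ellD : ℝ) * v c.D ≤ c.ellv v := by
  unfold ellD ellv
  rw [natCast_listSum, ← listSum_mul_const]
  refine listSum_mono _ _ _ fun g _ => ?_
  split_ifs with hb
  · rw [hb]; rfl
  · rw [Nat.cast_zero, zero_mul]; exact mul_nonneg (Nat.cast_nonneg _) (hv _)

/-- Facts extracted from `checkW`. -/
theorem checkW_spec (h : c.checkW = true) :
    0 < c.cD ∧ 1 ≤ c.h ∧ 0 < c.ellD ∧ (∀ g ∈ c.lin, c.linOK g = true) ∧ (∀ ch ∈ c.rows, ∀ r ∈ ch, c.rowOK r = true) := by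
  unfold checkW at h
  simp only [Bool.and_eq_true, decide_eq_true_eq, List.all_eq_true] at h
  obtain ⟨⟨⟨⟨h1, h2⟩, h3⟩, h4⟩, h5⟩ := h
  exact ⟨h1, h2, h3, h4, h5⟩

/-- If a pattern has `≥ 1` of the low `m` bits set, one of them is set. -/
theorem exists_tb_of_popc {m K : ℕ} (h : 1 ≤ popc m K) : ∃ x < m, tb K x = true := by
  unfold popc at h
  obtain ⟨x, hx⟩ := List.exists_mem_of_length_pos (by omega : 0 < ((List.range m).filter fun x => tb K x).length)
  rw [List.mem_filter, List.mem_range] at hx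
  exact ⟨x, hx.1, hx.2⟩

/-- With `v_D = 0`, the marginal hypotheses kill every pattern with a cut relay: `T(v) = 0`. -/
theorem tForm_eq_zero (hh : 1 ≤ c.h) (v : ℕ → ℝ) (hv : ∀ i, 0 ≤ v i)
    (hmarg : ∀ x < c.m, linv c.NV (fun i => bi (c.margMem x i)) v ≤ v c.D) (hD : v c.D = 0) :
    linv c.NV (fun i => bi (c.tMem i)) v = 0 := by
  unfold linv
  refine Finset.sum_eq_zero fun K hK => ?_
  by_cases ht : c.tMem K = true
  · have ht' := ht
    unfold tMem at ht'
    simp only [Bool.and_eq_true, decide_eq_true_eq] at ht'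
    obtain ⟨x, hxm, hxK⟩ := exists_tb_of_popc (le_trans hh ht'.2)
    have hmem : c.margMem x K = true := by
      unfold margMem; simp only [Bool.and_eq_true, decide_eq_true_eq]; exact ⟨ht'.1, hxK⟩
    have h1 := le_linv_of_mem c.NV (fun i => c.margMem x i) v hv K (Finset.mem_range.1 hK) hmem
    have h2 := hmarg x hxm
    have hK0 : v K = 0 := le_antisymm (by linarith) (hv K)
    rw [hK0, mul_zero]
  · simp [bi, ht]

/-- **SOUNDNESS OF THE CERTIFICATES.**  If `checkW` and the quadratic check on all variables pass, then at every nonnegative point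
`v` satisfying the marginal hypotheses `m_x(v) ≤ v_D` (`x < m`), the case chain `E_x(v) ≤ E_{x+1}(v)` (`x + 1 < m`) and the listed
rows on the mask forms (`f₁·f₂ ≤ f₃·f₄`), the conclusion `cD·T(v) ≤ cN·v_D` holds. -/
theorem sound (hW : c.checkW = true) (hQ : c.checkQ 0 c.NV = true) (v : ℕ → ℝ) (hv : ∀ i, 0 ≤ v i)
    (hmarg : ∀ x < c.m, linv c.NV (fun i => bi (c.margMem x i)) v ≤ v c.D)
    (hcase : ∀ x, x + 1 < c.m → linv c.NV (fun i => bi (c.eMem x i)) v ≤ linv c.NV (fun i => bi (c.eMem (x + 1) i)) v)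
    (hrows : ∀ ch ∈ c.rows, ∀ r ∈ ch,
      linv c.NV (fun i => bi (tb r.m1 i)) v * linv c.NV (fun i => bi (tb r.m2 i)) v ≤
        linv c.NV (fun i => bi (tb r.m3 i)) v * linv c.NV (fun i => bi (tb r.m4 i)) v) :
    (c.cD : ℝ) * linv c.NV (fun i => bi (c.tMem i)) v ≤ c.cN * v c.D := by
  obtain ⟨_, hh, hellD, hlin, _⟩ := c.checkW_spec hW
  -- the quadratic form is nonnegative
  have hquad : 0 ≤ quadv c.NV c.C v :=
    quadv_nonneg_of_symm c.NV c.C v hv fun i hi j hj => c.of_checkQ hQ (Nat.zero_le _) hi hj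
  -- its value splits into the three parts
  have hsplit : quadv c.NV c.C v = quadv c.NV c.linC v + quadv c.NV c.rowC v + quadv c.NV c.sqC v := by
    rw [show c.C = fun i j => (fun i' j' => c.linC i' j' + c.rowC i' j') i j + c.sqC i j from rfl, quadv_add,
      quadv_add]
  -- rows and squares are nonpositive
  have hrow : quadv c.NV c.rowC v ≤ 0 := by
    rw [c.quadv_rowC]
    refine listSum_nonpos _ _ fun ch hch => listSum_nonpos _ _ fun r hr => ?_
    rw [quadv_rowCoef]
    have := hrows ch hch r hr
    exact mul_nonpos_of_nonneg_of_nonpos (Nat.cast_nonneg _) (by linarith)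
  have hsq : quadv c.NV c.sqC v ≤ 0 := by
    rw [c.quadv_sqC]
    refine listSum_nonpos _ _ fun ch _ => listSum_nonpos _ _ fun s _ => ?_
    rw [quadv_sqCoef]
    have := mul_self_nonneg (linv c.NV s.u v)
    have := mul_nonneg (Nat.cast_nonneg (α := ℝ) s.n) this
    linarith
  -- the linear part is at most `Λ·ℓ(v)`
  have hlinle : quadv c.NV c.linC v ≤ c.Λ v * c.ellv v := by
    rw [c.quadv_linC, ellv, mul_comm, ← listSum_mul_const]
    refine listSum_mono _ _ _ fun g hg => ?_
    have hok := hlin g hg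
    have hb : g.1 < c.NV := by
      unfold linOK at hok; simp only [Bool.and_eq_true, decide_eq_true_eq] at hok; exact hok.1
    rw [if_pos hb, mul_assoc, mul_comm (v g.1), ← mul_assoc]
    exact mul_le_mul_of_nonneg_right (c.gval_le v hmarg hcase g hok) (hv _)
  have hmain : 0 ≤ c.Λ v * c.ellv v := by linarith
  have hell := c.ellD_mul_le v hv
  rcases eq_or_lt_of_le (hv c.D) with hD | hD
  · -- `v_D = 0`: the marginals force `T(v) = 0`
    rw [c.tForm_eq_zero hh v hv hmarg hD.symm, ← hD, mul_zero, mul_zero]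
  · -- `v_D > 0`: `ℓ(v) > 0`, so `Λ ≥ 0`
    have hellpos : 0 < c.ellv v := lt_of_lt_of_le (mul_pos (by exact_mod_cast hellD) hD) hell
    have hΛ : 0 ≤ c.Λ v := by
      by_contra hneg
      push Not at hneg
      have := mul_neg_of_neg_of_pos hneg hellpos
      linarith
    unfold Λ at hΛ
    linarith

end Cert

end

end QCert
end HubOnly

end Summit.CriticalPhenomena.PercolationContinuityZ3.Theorems
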